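import Summits.Schanuel.Schanuel.Theorems.DiophantineDichotomyKhovanskiiApproxTypeEvIffStubs
import Summits.Schanuel.Schanuel.Theorems.DiophantineDichotomyKhovanskiiApproxTypeEvRankThreeHardness
import Literature.Barriers.Schanuel.EFunctionValuesAtAlgebraicPoints
import HarnessLib

/-!
# Route `DiophantineDichotomy`, crux `KhovanskiiApproxTypeEv` (stmt-Schanuel-14972):
# the non-LW rank-2 layer proves `e ⊥ e^e` — hence the transcendence of `e^e`

Crux `Summit.Schanuel.Schanuel.Theses.DiophantineDichotomy.KhovanskiiApproxTypeEv`, line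
`anchored-reduction` (skeleton `Cruxes/KhovanskiiApproxTypeEv/Lines/Sketch.lean`, registered stubs
`stub_evNonLW_two : EvNonLWTwo`, `stub_evRankThreeUp : EvRankThreeUp`), lead c7.  Hardness
certificate of the registered stub `stub_evNonLW_two` (= leaf `NonLWLayerRankTwo` of the
strategist's split, `Cruxes/KhovanskiiApproxTypeEv/Split.lean`) at the free Khovanskii point
`s = (1, e)` — system `x₀ − 1 = 0`, `x₁ − y₀ = 0`, exponential Jacobian `((1, 0), (−e, 1))` of
determinant `1` — where `θ = (1, e, e, e^e)` and `ℚ(θ) = ℚ(e, e^e)`: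

* `algebraicIndependent_exp_expExp_of_evNonLWTwo : EvNonLWTwo → AlgebraicIndependent ℚ ![e, e^e]`
  — the level-one race (`schanuelTwo_of_evNonLWTwo`, p124730) at `(1, e)`; this is the statement the
  barrier file `Literature/Barriers/Schanuel/EFunctionValuesAtAlgebraicPoints.lean` derives from the
  FULL Schanuel conjecture (`algebraicIndependent_exp_expExp_of_schanuel`);
* `transcendental_exp_exp_of_evNonLWTwo : EvNonLWTwo → Transcendental ℚ (e^e)` and
  `irrational_exp_exp_of_evNonLWTwo` — the printed OPEN problem ("on ne sait rien de `π^e`, `π^π` ou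
  `e^e`", Rivoal 2024 §4 p. 204; registered open in the tree as the consequence
  `ExpExpNotEValue.transcendental_exp_exp` of the catalogued `@[conjecture] ExpExpNotEValue`);
* the same three conclusions from the crux itself (`…_of_khovanskiiApproxTypeEv`, via
  `evNonLWTwo_of_ev`, p125111).

So, besides `e ⊥ π` (p124086) and two algebraically independent logarithms (p124970), any Lean proof
of the stub `stub_evNonLW_two` (or of the crux as filed) is a Lean proof that `e^e` is
transcendental.  All implications are UNCONDITIONAL; nothing is credited to the summit; no `def`;
sorry-free; axioms standard.
-/

noncomputable section

-- `Summit.Schanuel.Schanuel.…` is the mandated summit/sub-problem namespace (single-conjunct summit), hence: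
set_option linter.dupNamespace false

namespace Summit.Schanuel.Schanuel.Cruxes.KhovanskiiApproxTypeEv.AnchoredReduction

open Summit.Schanuel.Schanuel.Theses.DiophantineDichotomy (KhovanskiiApproxTypeEv)
open Summit.Schanuel.Schanuel.Cruxes.KhovanskiiApproxType.LwSmallHeight (IsFreeKhovanskii)
open Literature.Barriers.Schanuel (algebraicIndependent_of_le_trdeg_adjoin linearIndependent_one_tau)
open Literature.NumberTheory.Transcendental (transcendental_rat_cexp_one)
open Complex

/-! ## The free Khovanskii point `s = (1, e)` -/

/-- `s = (1, e)` is a free Khovanskii point of rank `2`: a zero of the Khovanskii system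
`x₀ − 1 = 0`, `x₁ − y₀ = 0` (i.e. `s₀ = 1`, `s₁ = e^{s₀}`) whose exponential Jacobian
`(∂g_i/∂x_j + y_j ∂g_i/∂y_j) = ((1, 0), (−e, 1))` has determinant `1 ≠ 0`. [folklore] -/
theorem isFreeKhovanskii_one_expOne : IsFreeKhovanskii 2 ![(1 : ℂ), cexp 1] := by
  classical
  refine ⟨![MvPolynomial.X (Sum.inl 0) - MvPolynomial.C 1,
    MvPolynomial.X (Sum.inl 1) - MvPolynomial.X (Sum.inr 0)], ?_, ?_⟩
  · intro i
    fin_cases i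
    · simp
    · simp
  · rw [Matrix.det_fin_two]
    simp [Matrix.of_apply, MvPolynomial.pderiv_X]

/-- `1, e` are `ℚ`-linearly independent (`e` is irrational — indeed transcendental, Hermite).
[folklore] -/
theorem linearIndependent_one_expOne : LinearIndependent ℚ ![(1 : ℂ), cexp 1] :=
  linearIndependent_one_tau transcendental_rat_cexp_one

/-- `ℚ(1, e, e^1, e^e) = ℚ(e, e^e)` as intermediate fields of `ℂ / ℚ`. [folklore] -/
theorem adjoin_one_expOne_eq :
    IntermediateField.adjoin ℚ
        (Set.range ![(1 : ℂ), cexp 1] ∪ Set.range (cexp ∘ ![(1 : ℂ), cexp 1])) =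
      IntermediateField.adjoin ℚ (Set.range ![cexp 1, cexp (cexp 1)]) := by
  have hset : Set.range ![(1 : ℂ), cexp 1] ∪ Set.range (cexp ∘ ![(1 : ℂ), cexp 1]) =
      insert (1 : ℂ) (Set.range ![cexp 1, cexp (cexp 1)]) := by
    ext w
    simp only [Set.mem_union, Set.mem_range, Function.comp_apply, Set.mem_insert_iff]
    constructor
    · rintro (⟨i, rfl⟩ | ⟨i, rfl⟩) <;> fin_cases i <;> simp
    · rintro (rfl | ⟨i, rfl⟩)
      · exact Or.inl ⟨0, rfl⟩
      · fin_cases i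
        · exact Or.inl ⟨1, rfl⟩
        · exact Or.inr ⟨1, rfl⟩
  have hadj : IntermediateField.adjoin ℚ (insert (1 : ℂ) (Set.range ![cexp 1, cexp (cexp 1)])) =
      IntermediateField.adjoin ℚ (Set.range ![cexp 1, cexp (cexp 1)]) := by
    refine le_antisymm ?_ (IntermediateField.adjoin.mono _ _ _ (Set.subset_insert _ _))
    rw [IntermediateField.adjoin_le_iff, Set.insert_subset_iff]
    exact ⟨one_mem _, IntermediateField.subset_adjoin _ _⟩
  rw [hset, hadj]

/-! ## Stub 6 proves `e ⊥ e^e` and the transcendence of `e^e` -/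

/-- **Registered-stub hardness certificate `algebraicIndependent_exp_expExp_of_evNonLWTwo` — stub 6
proves `e ⊥ e^e`.**  `EvNonLWTwo` (eventual simultaneous approximation type `a < 1` at every free
Khovanskii point of `ℂ²` with a transcendental coordinate) gives, unconditionally, the algebraic
independence of `e` and `e^e` over `ℚ`: the level-one race `schanuelTwo_of_evNonLWTwo` at the free
Khovanskii point `(1, e)` yields `trdeg_ℚ ℚ(e, e^e) ≥ 2`.  The barrier catalogue derives the same
conclusion only from the full Schanuel conjecture (`algebraicIndependent_exp_expExp_of_schanuel`).
[cite: Rivoal2024, §5 p. 226] -/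
theorem algebraicIndependent_exp_expExp_of_evNonLWTwo :
    EvNonLWTwo → AlgebraicIndependent ℚ ![cexp 1, cexp (cexp 1)] := by
  intro hN
  have h2 := schanuelTwo_of_evNonLWTwo hN _ linearIndependent_one_expOne
    isFreeKhovanskii_one_expOne ⟨1, by simpa using transcendental_rat_cexp_one⟩
  exact algebraicIndependent_of_le_trdeg_adjoin _
    (h2.trans_eq (IntermediateField.equivOfEq adjoin_one_expOne_eq).trdeg_eq)

/-- **Stub 6 proves that `e^e` is transcendental** — printed OPEN ("on ne sait rien de `π^e`, `π^π`
ou `e^e`"; in the tree the consequence `ExpExpNotEValue.transcendental_exp_exp` of the catalogued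
open statement `Literature.Barriers.Schanuel.ExpExpNotEValue`).
[cite: Rivoal2024, §4 p. 204] -/
theorem transcendental_exp_exp_of_evNonLWTwo (hN : EvNonLWTwo) :
    Transcendental ℚ (Real.exp (Real.exp 1)) := by
  have h := (algebraicIndependent_exp_expExp_of_evNonLWTwo hN).transcendental 1
  simp only [Matrix.cons_val_one, Matrix.cons_val_fin_one] at h
  rw [show cexp (cexp 1) = ((Real.exp (Real.exp 1) : ℝ) : ℂ) by simp [Complex.ofReal_exp]] at h
  exact (transcendental_algebraMap_iff (A := ℂ) Complex.ofReal_injective).mp h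

/-- **Stub 6 proves that `e^e` is irrational** (not known either). [cite: Rivoal2024, §4 p. 204] -/
theorem irrational_exp_exp_of_evNonLWTwo (hN : EvNonLWTwo) : Irrational (Real.exp (Real.exp 1)) :=
  (transcendental_exp_exp_of_evNonLWTwo hN).irrational

/-! ## The crux as filed proves the same -/

/-- The crux `KhovanskiiApproxTypeEv` as filed proves `e ⊥ e^e` (through its non-LW rank-2 layer,
`evNonLWTwo_of_ev`, p125111). [cite: Rivoal2024, §5 p. 226] -/
theorem algebraicIndependent_exp_expExp_of_khovanskiiApproxTypeEv (hEv : KhovanskiiApproxTypeEv) :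
    AlgebraicIndependent ℚ ![cexp 1, cexp (cexp 1)] :=
  algebraicIndependent_exp_expExp_of_evNonLWTwo (evNonLWTwo_of_ev hEv)

/-- The crux `KhovanskiiApproxTypeEv` as filed proves the transcendence of `e^e` (open).
[cite: Rivoal2024, §4 p. 204] -/
theorem transcendental_exp_exp_of_khovanskiiApproxTypeEv (hEv : KhovanskiiApproxTypeEv) :
    Transcendental ℚ (Real.exp (Real.exp 1)) :=
  transcendental_exp_exp_of_evNonLWTwo (evNonLWTwo_of_ev hEv)

/-- The crux `KhovanskiiApproxTypeEv` as filed proves the irrationality of `e^e` (open).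
[cite: Rivoal2024, §4 p. 204] -/
theorem irrational_exp_exp_of_khovanskiiApproxTypeEv (hEv : KhovanskiiApproxTypeEv) :
    Irrational (Real.exp (Real.exp 1)) :=
  irrational_exp_exp_of_evNonLWTwo (evNonLWTwo_of_ev hEv)

end Summit.Schanuel.Schanuel.Cruxes.KhovanskiiApproxTypeEv.AnchoredReduction

end
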